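import Literature.AlgebraicGeometry.HodgeTheory.DerivedDescent
import HarnessLib

/-!
# Shift-compatibility of lifted natural transformations; the comparison `derivedLift Φ ≅ G.mapDerivedCategory`
# commutes with shifts

PROMOTED LITERATURE COPY (librarian protocol (b); DEFREQ-CoherentISemiregular, cell pub-hsemireg) of the generic, conjecture-free
`Summits/Ventures/HSemireg/DerivedDescentCommShift.lean` — namespace now `Literature.AlgebraicGeometry.HodgeTheory`, names kept; cell words (seats, ventures) = provenance.

Cell `pub-hsemireg`, Lean side (p3); sequel to `DerivedDescent.lean` (p330781); the generic half (i) of step (A2) of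
the cell's K2 anchor plan (HOME/lean/K2-ANCHOR-PLAN-p3.md; gs-g4 holds the specific half (ii)). HONEST FRAMING: Mathlib-level
category theory + its instantiation to `derivedLift`; NOT a door, NOT a fact, NOT a «K2 result», nothing about any variety.

* `natTrans_commShift_of_whiskerLeft` — shift-compatibility of a natural transformation between shift-commuting functors
  out of a localization `L` DESCENDS along `L`: if `whiskerLeft L τ'` is shift-compatible, so is `τ'`;
* `whiskerLeft_liftNatTrans` — `L ◫ liftNatTrans τ = ι₁.hom ≫ τ ≫ ι₂.inv` (the defining factorisation as one identity);
* **`natTrans_commShift_liftNatTrans`** — `Localization.liftNatTrans L W F₁ F₂ F₁' F₂' τ` is shift-compatible when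
  the factorisation isomorphisms `L ⋙ Fᵢ' ≅ Fᵢ` and `τ` are (Mathlib has this only for the factorisation isos
  themselves, `NatTrans.commShift_iso_hom_of_localization`);
* `natTrans_commShift_derivedLiftIsoMapDerivedCategory_hom` — for a cochain-level isomorphism
  `e : Φ ≅ G.mapHomologicalComplex` with `NatTrans.CommShift e.hom ℤ`, the comparison
  `derivedLiftIsoMapDerivedCategory Φ hΦ G e : derivedLift Φ ≅ G.mapDerivedCategory` is shift-compatible, hence
  (`shiftedHom_map_derivedLift_eq`, Mathlib `ShiftedHom.map_naturality_1`) the action `x.map (derivedLift Φ)` on shifted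
  Homs is conjugate to Mathlib's `x.map G.mapDerivedCategory` — the arrow through which `shiftedHomMap` meets
  `Ext.mapExactFunctor` in the anchor.

## References

* Mathlib: `CategoryTheory.Shift.Localization` (`Functor.commShiftOfLocalization`, `NatTrans.commShift_iso_hom_of_localization`),
  `CategoryTheory.Shift.CommShift` (`NatTrans.CommShift` and its `comp`/`whiskerRight`/`of_iso_inv` instances),
  `CategoryTheory.Shift.ShiftedHom` (`ShiftedHom.map_naturality_1`); all statements here are folklore consequences.
-/

noncomputable section

open CategoryTheory CategoryTheory.Category

namespace Literature.AlgebraicGeometry.HodgeTheory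

universe v₁ v₂ v₃ u₁ u₂ u₃ w

section Descend

variable {C : Type u₁} {D : Type u₂} [Category.{v₁} C] [Category.{v₂} D]
  {E : Type u₃} [Category.{v₃} E]
  (L : C ⥤ D)
  (A : Type w) [AddMonoid A] [HasShift C A] [HasShift D A] [HasShift E A] [L.CommShift A]
  {F₁' F₂' : D ⥤ E} [F₁'.CommShift A] [F₂'.CommShift A] (τ' : F₁' ⟶ F₂')

/-- **Shift-compatibility descends along a localization functor**: if `L` is a localization functor commuting
with shifts and `τ' : F₁' ⟶ F₂'` is a natural transformation of shift-commuting functors out of the localization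
such that `L ◫ τ'` (`whiskerLeft L τ'`, for the composite `CommShift` structures) is shift-compatible, then `τ'` is.
[cite: Weibel1994, Def. 10.3.1 and Cor. 10.4.7 (localisation at quasi-isomorphisms)] -/
theorem natTrans_commShift_of_whiskerLeft (W : MorphismProperty C) [L.IsLocalization W]
    [NatTrans.CommShift (Functor.whiskerLeft L τ') A] : NatTrans.CommShift τ' A where
  shift_comm a := by
    apply Localization.natTrans_ext L W
    intro X
    have h := NatTrans.shift_app_comm (Functor.whiskerLeft L τ') a X
    simp only [NatTrans.comp_app, Functor.whiskerRight_app, Functor.whiskerLeft_app,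
      Functor.commShiftIso_comp_hom_app] at h ⊢
    -- `h : F₁' eL ≫ c₁' ≫ (τ' (L X))⟦a⟧ = τ' (L (X⟦a⟧)) ≫ F₂' eL ≫ c₂'`
    have n := τ'.naturality ((L.commShiftIso a).hom.app X)
    -- `n : F₁' eL ≫ τ' ((L X)⟦a⟧) = τ' (L (X⟦a⟧)) ≫ F₂' eL`
    try erw [Category.assoc] at h
    apply (cancel_epi (F₁'.map ((L.commShiftIso a).hom.app X))).mp
    erw [h]
    erw [← Category.assoc, ← n, Category.assoc]
    try rfl

end Descend

section Lift

variable {C : Type u₁} {D : Type u₂} [Category.{v₁} C] [Category.{v₂} D]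
  {E : Type u₃} [Category.{v₃} E]
  (L : C ⥤ D) (W : MorphismProperty C) [L.IsLocalization W]
  (A : Type w) [AddMonoid A] [HasShift C A] [HasShift D A] [HasShift E A] [L.CommShift A]
  (F₁ F₂ : C ⥤ E) [F₁.CommShift A] [F₂.CommShift A]
  (F₁' F₂' : D ⥤ E) [F₁'.CommShift A] [F₂'.CommShift A]
  [Localization.Lifting L W F₁ F₁'] [Localization.Lifting L W F₂ F₂']
  (τ : F₁ ⟶ F₂)

/-- The defining property of `liftNatTrans` as an identity of natural transformations:
`L ◫ liftNatTrans τ = ι₁.hom ≫ τ ≫ ι₂.inv`. [cite: Weibel1994, Def. 10.3.1 and Cor. 10.4.7 (localisation at quasi-isomorphisms)] -/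
lemma whiskerLeft_liftNatTrans :
    Functor.whiskerLeft L (Localization.liftNatTrans L W F₁ F₂ F₁' F₂' τ) =
      (Localization.Lifting.iso L W F₁ F₁').hom ≫ τ ≫ (Localization.Lifting.iso L W F₂ F₂').inv := by
  ext X
  simp [Localization.liftNatTrans_app]

variable [NatTrans.CommShift (Localization.Lifting.iso L W F₁ F₁').hom A]
  [NatTrans.CommShift (Localization.Lifting.iso L W F₂ F₂').hom A] [NatTrans.CommShift τ A]

/-- **`liftNatTrans` commutes with shifts** when the data does: if the factorisation isomorphisms
`L ⋙ Fᵢ' ≅ Fᵢ` and `τ : F₁ ⟶ F₂` are shift-compatible, so is `liftNatTrans L W F₁ F₂ F₁' F₂' τ : F₁' ⟶ F₂'`.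
[cite: Weibel1994, Def. 10.3.1 and Cor. 10.4.7 (localisation at quasi-isomorphisms)] -/
theorem natTrans_commShift_liftNatTrans :
    NatTrans.CommShift (Localization.liftNatTrans L W F₁ F₂ F₁' F₂' τ) A := by
  have : NatTrans.CommShift (Functor.whiskerLeft L (Localization.liftNatTrans L W F₁ F₂ F₁' F₂' τ)) A := by
    rw [whiskerLeft_liftNatTrans]
    infer_instance
  exact natTrans_commShift_of_whiskerLeft L A _ W

end Lift

end Literature.AlgebraicGeometry.HodgeTheory

/-! ### Instantiation to `derivedLift` -/

namespace Literature.AlgebraicGeometry.HodgeTheory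

universe w' v' u'

variable {C : Type u'} [Category.{v'} C] [Abelian C] [HasDerivedCategory.{w'} C]
  (Φ : CochainComplex C ℤ ⥤ CochainComplex C ℤ) [Φ.CommShift ℤ]
  (hΦ : (HomologicalComplex.quasiIso C (ComplexShape.up ℤ)).IsInvertedBy (Φ ⋙ DerivedCategory.Q))
  (G : C ⥤ C) [G.Additive] [Limits.PreservesFiniteLimits G] [Limits.PreservesFiniteColimits G]
  (e : Φ ≅ G.mapHomologicalComplex (ComplexShape.up ℤ)) [NatTrans.CommShift e.hom ℤ]

/-- **(A2)(i)**: if the cochain-level iso `e : Φ ≅ G.mapHomologicalComplex` is shift-compatible, so is the derived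
comparison `derivedLiftIsoMapDerivedCategory Φ hΦ G e : derivedLift Φ ≅ G.mapDerivedCategory`.
[cite: Weibel1994, Def. 10.3.1 and Cor. 10.4.7 (localisation at quasi-isomorphisms)] -/
theorem natTrans_commShift_derivedLiftIsoMapDerivedCategory_hom :
    NatTrans.CommShift (derivedLiftIsoMapDerivedCategory Φ hΦ G e).hom ℤ := by
  haveI : NatTrans.CommShift (Localization.Lifting.iso DerivedCategory.Q
      (HomologicalComplex.quasiIso C (ComplexShape.up ℤ)) (G.mapHomologicalComplex (ComplexShape.up ℤ) ⋙
        DerivedCategory.Q) G.mapDerivedCategory).hom ℤ :=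
    inferInstanceAs (NatTrans.CommShift G.mapDerivedCategoryFactors.hom ℤ)
  haveI : NatTrans.CommShift (Functor.isoWhiskerRight e DerivedCategory.Q).hom ℤ :=
    inferInstanceAs (NatTrans.CommShift (Functor.whiskerRight e.hom DerivedCategory.Q) ℤ)
  exact natTrans_commShift_liftNatTrans DerivedCategory.Q (HomologicalComplex.quasiIso C (ComplexShape.up ℤ)) ℤ
    (Φ ⋙ DerivedCategory.Q) (G.mapHomologicalComplex (ComplexShape.up ℤ) ⋙ DerivedCategory.Q)
    (derivedLift Φ hΦ) G.mapDerivedCategory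
    (Functor.isoWhiskerRight e DerivedCategory.Q).hom

/-- **Consequence**: `shiftedHomMap Φ` is conjugate to `ShiftedHom.map (G.mapDerivedCategory)` along the
comparison iso (Mathlib `ShiftedHom.map_naturality_1`). [cite: Weibel1994, Def. 10.3.1 and Cor. 10.4.7 (localisation at quasi-isomorphisms)] -/
theorem shiftedHom_map_derivedLift_eq {K L : CochainComplex C ℤ} {n : ℤ}
    (x : ShiftedHom (DerivedCategory.Q.obj K) (DerivedCategory.Q.obj L) n) :
    (ShiftedHom.mk₀ 0 rfl ((derivedLiftIsoMapDerivedCategory Φ hΦ G e).inv.app _)).comp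
        ((x.map (derivedLift Φ hΦ)).comp
          (ShiftedHom.mk₀ 0 rfl ((derivedLiftIsoMapDerivedCategory Φ hΦ G e).hom.app _))
          (zero_add _)) (add_zero _) =
      x.map G.mapDerivedCategory := by
  haveI := natTrans_commShift_derivedLiftIsoMapDerivedCategory_hom Φ hΦ G e
  exact ShiftedHom.map_naturality_1 x (derivedLiftIsoMapDerivedCategory Φ hΦ G e)

end Literature.AlgebraicGeometry.HodgeTheory

end
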